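import Summits.Ventures.PercRepro.RankLevelSetRuleQCell

/-!
# PercRepro — RULE Q AT THE TIGHT LAYER: THE CELL INEQUALITIES `RhatCell q k` BY KERNEL EVALUATION (RankLevelSetRuleQCellEvalQ2B; night-1, gen 14)

Each theorem `rhatCell_q_k : RhatCell q k` (`∀ m ≤ q, Φ(q+k, q) ≤ R̂(q, k, m)`, RankLevelSetRuleQCell) is discharged by
`interval_cases m` and `norm_num` on the unfolded binomial sums (`Nat.choose` by its recursion; the
`Finset.Ioo`-sums as `Finset.range`-sums via `sum_Ioo_nat`). No `native_decide`, no `decide` on the rationals. With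
`hallUp_of_ncard_eq_of_rhatCell` each cell gives the UP form of C-044 at the tight layer `#E = (q+k) + q` of the cell
`(q+k, q)` for every finite matroid; the DOWN form is `hallDown_of_ncard_eq`. Cells: (2,17), (2,18), (2,19), (2,20).
Axioms: standard.
-/

namespace PercRepro

open Finset

/-- `Φ(19, 2) ≤ R̂(2, 17, 0)` (the cell `(19, 2)` at `#P = 0`), by kernel evaluation. -/
theorem rhatCell_2_17_0 : phiK (2 + 17) 2 ≤ rhat 2 17 0 := by
  simp only [rhat, phiK, mhat, sum_Ioo_nat]
  norm_num [Finset.sum_range_succ, Nat.choose, Nat.min_def]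

/-- `Φ(19, 2) ≤ R̂(2, 17, 1)` (the cell `(19, 2)` at `#P = 1`), by kernel evaluation. -/
theorem rhatCell_2_17_1 : phiK (2 + 17) 2 ≤ rhat 2 17 1 := by
  simp only [rhat, phiK, mhat, sum_Ioo_nat]
  norm_num [Finset.sum_range_succ, Nat.choose, Nat.min_def]

/-- `Φ(19, 2) ≤ R̂(2, 17, 2)` (the cell `(19, 2)` at `#P = 2`), by kernel evaluation. -/
theorem rhatCell_2_17_2 : phiK (2 + 17) 2 ≤ rhat 2 17 2 := by
  simp only [rhat, phiK, mhat, sum_Ioo_nat]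
  norm_num [Finset.sum_range_succ, Nat.choose, Nat.min_def]

/-- The cell `(19, 2)` (`q = 2`, `k = 17`): `Φ(19, 2) ≤ R̂(2, 17, m)` for every `m ≤ 2`. -/
theorem rhatCell_2_17 : RhatCell 2 17 := by
  intro m hm
  interval_cases m
  · exact rhatCell_2_17_0
  · exact rhatCell_2_17_1
  · exact rhatCell_2_17_2

/-- `Φ(20, 2) ≤ R̂(2, 18, 0)` (the cell `(20, 2)` at `#P = 0`), by kernel evaluation. -/
theorem rhatCell_2_18_0 : phiK (2 + 18) 2 ≤ rhat 2 18 0 := by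
  simp only [rhat, phiK, mhat, sum_Ioo_nat]
  norm_num [Finset.sum_range_succ, Nat.choose, Nat.min_def]

/-- `Φ(20, 2) ≤ R̂(2, 18, 1)` (the cell `(20, 2)` at `#P = 1`), by kernel evaluation. -/
theorem rhatCell_2_18_1 : phiK (2 + 18) 2 ≤ rhat 2 18 1 := by
  simp only [rhat, phiK, mhat, sum_Ioo_nat]
  norm_num [Finset.sum_range_succ, Nat.choose, Nat.min_def]

/-- `Φ(20, 2) ≤ R̂(2, 18, 2)` (the cell `(20, 2)` at `#P = 2`), by kernel evaluation. -/
theorem rhatCell_2_18_2 : phiK (2 + 18) 2 ≤ rhat 2 18 2 := by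
  simp only [rhat, phiK, mhat, sum_Ioo_nat]
  norm_num [Finset.sum_range_succ, Nat.choose, Nat.min_def]

/-- The cell `(20, 2)` (`q = 2`, `k = 18`): `Φ(20, 2) ≤ R̂(2, 18, m)` for every `m ≤ 2`. -/
theorem rhatCell_2_18 : RhatCell 2 18 := by
  intro m hm
  interval_cases m
  · exact rhatCell_2_18_0
  · exact rhatCell_2_18_1
  · exact rhatCell_2_18_2

/-- `Φ(21, 2) ≤ R̂(2, 19, 0)` (the cell `(21, 2)` at `#P = 0`), by kernel evaluation. -/
theorem rhatCell_2_19_0 : phiK (2 + 19) 2 ≤ rhat 2 19 0 := by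
  simp only [rhat, phiK, mhat, sum_Ioo_nat]
  norm_num [Finset.sum_range_succ, Nat.choose, Nat.min_def]

/-- `Φ(21, 2) ≤ R̂(2, 19, 1)` (the cell `(21, 2)` at `#P = 1`), by kernel evaluation. -/
theorem rhatCell_2_19_1 : phiK (2 + 19) 2 ≤ rhat 2 19 1 := by
  simp only [rhat, phiK, mhat, sum_Ioo_nat]
  norm_num [Finset.sum_range_succ, Nat.choose, Nat.min_def]

/-- `Φ(21, 2) ≤ R̂(2, 19, 2)` (the cell `(21, 2)` at `#P = 2`), by kernel evaluation. -/
theorem rhatCell_2_19_2 : phiK (2 + 19) 2 ≤ rhat 2 19 2 := by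
  simp only [rhat, phiK, mhat, sum_Ioo_nat]
  norm_num [Finset.sum_range_succ, Nat.choose, Nat.min_def]

/-- The cell `(21, 2)` (`q = 2`, `k = 19`): `Φ(21, 2) ≤ R̂(2, 19, m)` for every `m ≤ 2`. -/
theorem rhatCell_2_19 : RhatCell 2 19 := by
  intro m hm
  interval_cases m
  · exact rhatCell_2_19_0
  · exact rhatCell_2_19_1
  · exact rhatCell_2_19_2

/-- `Φ(22, 2) ≤ R̂(2, 20, 0)` (the cell `(22, 2)` at `#P = 0`), by kernel evaluation. -/
theorem rhatCell_2_20_0 : phiK (2 + 20) 2 ≤ rhat 2 20 0 := by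
  simp only [rhat, phiK, mhat, sum_Ioo_nat]
  norm_num [Finset.sum_range_succ, Nat.choose, Nat.min_def]

/-- `Φ(22, 2) ≤ R̂(2, 20, 1)` (the cell `(22, 2)` at `#P = 1`), by kernel evaluation. -/
theorem rhatCell_2_20_1 : phiK (2 + 20) 2 ≤ rhat 2 20 1 := by
  simp only [rhat, phiK, mhat, sum_Ioo_nat]
  norm_num [Finset.sum_range_succ, Nat.choose, Nat.min_def]

/-- `Φ(22, 2) ≤ R̂(2, 20, 2)` (the cell `(22, 2)` at `#P = 2`), by kernel evaluation. -/
theorem rhatCell_2_20_2 : phiK (2 + 20) 2 ≤ rhat 2 20 2 := by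
  simp only [rhat, phiK, mhat, sum_Ioo_nat]
  norm_num [Finset.sum_range_succ, Nat.choose, Nat.min_def]

/-- The cell `(22, 2)` (`q = 2`, `k = 20`): `Φ(22, 2) ≤ R̂(2, 20, m)` for every `m ≤ 2`. -/
theorem rhatCell_2_20 : RhatCell 2 20 := by
  intro m hm
  interval_cases m
  · exact rhatCell_2_20_0
  · exact rhatCell_2_20_1
  · exact rhatCell_2_20_2

end PercRepro
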